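import Summits.HubbardSuperconductivity.HubbardSuperconductivity.Theses.InfiniteVolumeFirst
import Summits.HubbardSuperconductivity.HubbardSuperconductivity.Theorems.WindowInfraredBound.Negative.AllSectorStates
import Literature.Barriers.HubbardSuperconductivity.PureModelStripeCompetitionProofs

/-!
# Crux `NoInfraredPileUp` (item `stmt-HubbardSuperconductivity-18534`, route InfiniteVolumeFirst rank 3):
# the ground-state hypothesis is load-bearing — the SOFT tightness FAILS over all normalised sector states

`not_noInfraredPileUpAllSectorStates`.  The crux asks, at weak coupling and for every admissible
GROUND-STATE family `ψ_L`, that the small-momentum window tail of the `d`-wave pair structure factor be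
tight: `∀ η > 0 ∃ ε > 0 ∃ L₀ ∀ even L ≥ L₀, T_ε(ψ_L) := Σ_{m ≠ 0, |q_m| ≤ ε} S_{ψ_L}(m) ≤ η L²`
(`S_ψ(m) = pairStructureFactor dWaveFormFactor L ψ m = ‖Δ_d(m)ψ‖²/L²`).  Replace
`IsGroundStateInSector (hubbardTorus 2 L 1 U) (N L) 0 (ψ L)` by mere sector membership
`ψ L ∈ szSector (N L) 0` (normalisation kept) and the statement is FALSE — unconditionally, with an
explicit witness family, although the soft form has NO rate and lets `ε, L₀` depend on the family.

WITNESS.  At `δ = 1/4` take, at the sides `L = 12t`, the Lieb–Schultz–Mattis-twisted Dicke condensate of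
the sibling crux's negative file (`exists_sector_state_large_pairStructureFactor`,
`…/WindowInfraredBound/Negative/AllSectorStates.lean`): a unit vector of the sector `(2·54t², 0) =
(2⌊(3/4)L²/2⌋, 0)` with `S_ψ(2ê₁) ≥ t²/8 = L²/1152` at the window momentum `|q| = 4π/L`; at every other
side any unit sector ground state (`exists_unit_isGroundStateInSector_hubbardTorus`, in particular a sector
vector).  For `η = 1/2000 < 1/1152` no `ε, L₀` works: the side `L = 12t ≥ max L₀ (4π/ε)` is even, the mode
`2ê₁` lies in the window, and `T_ε(ψ_L) ≥ L²/1152 > L²/2000`.  Physically: `Θ(L²)` `d`-wave pairs condensed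
at the smallest window momenta (a "sliding"/generalised pair condensate) live in every sector; only the
ENERGY (the exact eigen-equation — and by the strategist's `WallSoft.lean`, not even `O(1)` closeness to
`E₀` if the phase is ordered) can exclude them.  Companion of the standing disprover's work file
`Cruxes/NoInfraredPileUp/Disproof.lean` §2.  Sources: R. H. Dicke, Phys. Rev. 93 (1954) 99; C. N. Yang,
Rev. Mod. Phys. 34 (1962) 694, §5; H. Watanabe, J. Stat. Phys. 177 (2019) 717, §2.2.1;
M. Girardeau, J. Math. Phys. 1 (1960) 516 / Phys. Fluids 5 (1962) 1468 (generalised condensation).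
-/

-- the mandated namespace `Summit.<Summit>.<Problem>.Theorems` repeats `HubbardSuperconductivity`
-- (single-problem summit, D-0017), which the `dupNamespace` linter flags on every declaration
set_option linter.dupNamespace false

noncomputable section

namespace Summit.HubbardSuperconductivity.HubbardSuperconductivity.Theorems.NoInfraredPileUp.Negative

open Literature.MathematicalPhysics.QuantumLattice Literature.Probability.LatticeModels
  Literature.Barriers.HubbardSuperconductivity Matrix Finset
open Summit.HubbardSuperconductivity.HubbardSuperconductivity.Theorems.WindowInfraredBound.Negative
open scoped ComplexOrder

/-- **The ground-state hypothesis of `NoInfraredPileUp` is load-bearing.**  The crux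
`InfiniteVolumeFirst.NoInfraredPileUp` with `IsGroundStateInSector (hubbardTorus 2 L 1 U) (N L) 0 (ψ L)`
weakened to `ψ L ∈ szSector (N L) 0` (everything else verbatim: doping window, weak coupling,
normalisation, the rate-free `∀ η ∃ ε ∃ L₀` conclusion with `ε, L₀` allowed to depend on the family) is
FALSE.  At `δ = 1/4`, `U = U₁/2`, the family "twisted Dicke condensate at the sides `12t`, a unit sector
ground state elsewhere" is admissible for the weakened statement and has
`T_ε(ψ_{12t}) ≥ S_{ψ_{12t}}(2ê₁) ≥ t²/8 = L²/1152` as soon as `12t ≥ 4π/ε`, defeating `η = 1/2000`.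
Dicke, Phys. Rev. 93 (1954) 99; Yang, Rev. Mod. Phys. 34 (1962) 694, §5; Watanabe, J. Stat. Phys. 177
(2019) 717, §2.2.1. [folklore] -/
theorem not_noInfraredPileUpAllSectorStates :
    ¬ (∀ δ ∈ Set.Ioo (0:ℝ) (1 / 2), ∃ U₁ : ℝ, 0 < U₁ ∧ ∀ U ∈ Set.Ioo (0:ℝ) U₁,
        ∀ (N : ℕ → ℕ) (ψ : ∀ L, Fock (Orb (FermionTorus 2 L))),
          (∀ L, Even L → N L = 2 * ⌊(1 - δ) * (L : ℝ) ^ 2 / 2⌋₊ ∧ star (ψ L) ⬝ᵥ ψ L = 1 ∧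
              ψ L ∈ szSector (Λ := FermionTorus 2 L) (N L) 0) →
            ∀ η : ℝ, 0 < η → ∃ ε : ℝ, 0 < ε ∧ ∃ L₀ : ℕ, ∀ (L : ℕ) [NeZero L], Even L → L₀ ≤ L →
              (∑ m : Fin 2 → ZMod L, if m ≠ 0 ∧ momentumNormSq L m ≤ ε ^ 2 then
                  pairStructureFactor dWaveFormFactor L (ψ L) m else 0) ≤ η * (L : ℝ) ^ 2) := by
  intro h
  obtain ⟨U₁, hU₁, hB⟩ := h (1 / 4) ⟨by norm_num, by norm_num⟩
  have hU : U₁ / 2 ∈ Set.Ioo (0:ℝ) U₁ := ⟨by positivity, by linarith⟩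
  have hδ1 : (-1 : ℝ) ≤ 1 / 4 := by norm_num
  -- Step 1: the family at the sides `n + 1`: the twisted Dicke condensate at `n + 1 = 12t`, a unit
  -- sector ground state otherwise
  have key : ∀ n : ℕ, ∃ φ : Fock (Orb (FermionTorus 2 (n + 1))),
      (star φ ⬝ᵥ φ = 1 ∧
        φ ∈ szSector (Λ := FermionTorus 2 (n + 1)) (2 * ⌊(1 - 1 / 4) * ((n + 1 : ℕ) : ℝ) ^ 2 / 2⌋₊) 0) ∧
      ∀ t : ℕ, 1 ≤ t → n + 1 = 12 * t →
        (t : ℝ) ^ 2 / 8 ≤ pairStructureFactor dWaveFormFactor (n + 1) φ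
          (-(Pi.single 0 (((2 * (-1 : ℤ) : ℤ)) : ZMod (n + 1)))) := by
    intro n
    by_cases hc : ∃ t : ℕ, 1 ≤ t ∧ n + 1 = 12 * t
    · obtain ⟨t, ht, hnt⟩ := hc
      obtain ⟨ψ, hψ1, hψmem, hψS⟩ :=
        exists_sector_state_large_pairStructureFactor (L := n + 1) ht hnt
      have hfloor : 2 * ⌊(1 - 1 / 4) * (((n + 1 : ℕ)) : ℝ) ^ 2 / 2⌋₊ = 2 * (54 * t ^ 2) := by
        have : (1 - 1 / 4) * (((n + 1 : ℕ)) : ℝ) ^ 2 / 2 = ((54 * t ^ 2 : ℕ) : ℝ) := by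
          rw [hnt]; push_cast; ring
        rw [this, Nat.floor_natCast]
      refine ⟨ψ, ⟨hψ1, hfloor ▸ hψmem⟩, fun t' _ hnt' => ?_⟩
      have htt : t' = t := by omega
      subst htt
      exact hψS
    · obtain ⟨ψ, hψ1, hψGS⟩ := exists_unit_isGroundStateInSector_hubbardTorus (U₁ / 2) (n + 1) _
        (natFloor_filling_le_sq hδ1 (n + 1))
      exact ⟨ψ, ⟨hψ1, hψGS.1⟩, fun t ht hnt => (hc ⟨t, ht, hnt⟩).elim⟩
  choose φ₁ hφ₁ using key
  -- the side-`0` vector and the family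
  obtain ⟨φ00, hφ00, hφ00GS⟩ := exists_unit_isGroundStateInSector_hubbardTorus (U₁ / 2) 0 _
    (natFloor_filling_le_sq hδ1 0)
  obtain ⟨φ, hφ0, hφs⟩ : ∃ φ : ∀ L, Fock (Orb (FermionTorus 2 L)), φ 0 = φ00 ∧ ∀ n, φ (n + 1) = φ₁ n :=
    ⟨fun L => match L with
      | 0 => φ00
      | n + 1 => φ₁ n, rfl, fun _ => rfl⟩
  -- Step 2: admissibility of the family for the weakened crux
  have hadm : ∀ L, Even L → (fun L : ℕ => 2 * ⌊(1 - 1 / 4) * (L : ℝ) ^ 2 / 2⌋₊) L =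
        2 * ⌊(1 - 1 / 4) * (L : ℝ) ^ 2 / 2⌋₊ ∧ star (φ L) ⬝ᵥ φ L = 1 ∧
      φ L ∈ szSector (Λ := FermionTorus 2 L) ((fun L : ℕ => 2 * ⌊(1 - 1 / 4) * (L : ℝ) ^ 2 / 2⌋₊) L) 0 := by
    intro L _
    refine ⟨rfl, ?_⟩
    cases L with
    | zero =>
      rw [hφ0]
      exact ⟨hφ00, hφ00GS.1⟩
    | succ n =>
      rw [hφs]
      exact (hφ₁ n).1
  obtain ⟨ε, hε, L₀, hwin⟩ := hB (U₁ / 2) hU _ φ hadm (1 / 2000) (by norm_num)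
  -- Step 3: the side `n + 1 = 12 t ≥ max L₀ (4π/ε)`
  obtain ⟨t, htdef⟩ : ∃ t : ℕ, t = L₀ + ⌈4 * Real.pi / ε⌉₊ + 1 := ⟨_, rfl⟩
  have ht : 1 ≤ t := by omega
  obtain ⟨n, hndef⟩ : ∃ n : ℕ, n = 12 * t - 1 := ⟨_, rfl⟩
  have hnt : n + 1 = 12 * t := by omega
  have hEven : Even (n + 1) := ⟨6 * t, by omega⟩
  have hL₀ : L₀ ≤ n + 1 := by omega
  have htr : (4 * Real.pi / ε : ℝ) ≤ t := by
    have h1 := Nat.le_ceil (4 * Real.pi / ε)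
    have h2 : ((⌈4 * Real.pi / ε⌉₊ : ℕ) : ℝ) ≤ t := by
      rw [htdef]; push_cast; linarith [show (0:ℝ) ≤ L₀ from Nat.cast_nonneg _]
    linarith
  have htpos : (0 : ℝ) < t := by exact_mod_cast ht
  have hLr : ((n + 1 : ℕ) : ℝ) = 12 * t := by rw [hnt]; push_cast; ring
  have hLpos : (0 : ℝ) < ((n + 1 : ℕ) : ℝ) := by positivity
  -- Step 4: the window of the witness at that side
  have hw := hwin (n + 1) hEven hL₀
  rw [hφs] at hw
  have hS := (hφ₁ n).2 t ht hnt
  obtain ⟨m₀, hm₀⟩ : ∃ m₀ : TorusSite 2 (n + 1), m₀ = -(Pi.single 0 (((2 * (-1 : ℤ) : ℤ)) : ZMod (n + 1))) :=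
    ⟨_, rfl⟩
  rw [← hm₀] at hS
  have hm₀0 : m₀ 0 = ((2 : ℕ) : ZMod (n + 1)) := by
    rw [hm₀, Pi.neg_apply, Pi.single_eq_same]
    push_cast
    ring
  have hm₀1 : m₀ 1 = 0 := by
    rw [hm₀, Pi.neg_apply, Pi.single_eq_of_ne (by decide : (1 : Fin 2) ≠ 0), neg_zero]
  have hval : (m₀ 0).valMinAbs = 2 := by
    rw [hm₀0]
    exact_mod_cast ZMod.valMinAbs_natCast_of_le_half (n := n + 1) (a := 2) (by omega)
  have hm₀ne : m₀ ≠ 0 := by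
    intro h0
    have h2 := congrArg (fun m : TorusSite 2 (n + 1) => (m 0).valMinAbs) h0
    simp only [hval, Pi.zero_apply, ZMod.valMinAbs_zero] at h2
    omega
  have hnorm : momentumNormSq (n + 1) m₀ ≤ ε ^ 2 := by
    rw [momentumNormSq_apply, Fin.sum_univ_two, hval, hm₀1, ZMod.valMinAbs_zero, hLr]
    push_cast
    -- `(2π/(12t))² · 4 ≤ ε²` from `4π/ε ≤ t ≤ 12t`
    have h1 : 4 * Real.pi ≤ ε * (12 * t) := by
      rw [div_le_iff₀ hε] at htr
      nlinarith [Real.pi_pos, mul_pos htpos hε]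
    have h2 : 2 * Real.pi / (12 * (t : ℝ)) * 2 ≤ ε := by
      rw [div_mul_eq_mul_div, div_le_iff₀ (by positivity)]
      linarith
    have h3 : 0 ≤ 2 * Real.pi / (12 * (t : ℝ)) * 2 := by positivity
    nlinarith [mul_self_le_mul_self h3 h2]
  -- the window sum is at least its `m₀` term
  have hterm : pairStructureFactor dWaveFormFactor (n + 1) (φ₁ n) m₀ ≤
      ∑ m : TorusSite 2 (n + 1), if m ≠ 0 ∧ momentumNormSq (n + 1) m ≤ ε ^ 2 then
        pairStructureFactor dWaveFormFactor (n + 1) (φ₁ n) m else 0 := by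
    have h0 : (if m₀ ≠ 0 ∧ momentumNormSq (n + 1) m₀ ≤ ε ^ 2 then
        pairStructureFactor dWaveFormFactor (n + 1) (φ₁ n) m₀ else 0) =
          pairStructureFactor dWaveFormFactor (n + 1) (φ₁ n) m₀ := if_pos ⟨hm₀ne, hnorm⟩
    rw [← h0]
    exact Finset.single_le_sum (f := fun m => if m ≠ 0 ∧ momentumNormSq (n + 1) m ≤ ε ^ 2 then
        pairStructureFactor dWaveFormFactor (n + 1) (φ₁ n) m else 0)
      (fun m _ => by
        split_ifs
        · exact pairStructureFactor_nonneg _ _ _ _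
        · exact le_rfl)
      (Finset.mem_univ _)
  -- contradiction: `t²/8 ≤ S(m₀) ≤ T_ε ≤ (1/2000) (12t)² = 0.072 t² < t²/8`
  have hup : 1 / 2000 * (((n + 1 : ℕ)) : ℝ) ^ 2 < (t : ℝ) ^ 2 / 8 := by
    rw [hLr]
    nlinarith [sq_nonneg (t : ℝ), htpos]
  linarith [hS, hterm, hw, hup]

end Summit.HubbardSuperconductivity.HubbardSuperconductivity.Theorems.NoInfraredPileUp.Negative
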